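import Mathlib
import Literature.Analysis.FluidPDE.SpaceTimeCalculus
import Literature.Analysis.FluidPDE.ClassicalSolutionCalculus
import Literature.Analysis.FluidPDE.PineauVicolSliceEnstrophy
import Literature.Analysis.FluidPDE.VectorCalculus
import HarnessLib

/-!
# Modulated Galilean modes of a Navier–Stokes pair: regularity, tempered growth, incompressibility

Registered stub `stub_galileanModeRegular` (B2a) of the lead's skeleton for crux
stmt-NavierStokesRegularity-4054 (`SymmetryModuliCount.LinearLiouvilleSeven`), line
`galilean-collapse`, Part B (the structural collapse `LL7 → X`).

For a pair `(u, p)` jointly smooth on `(−∞, 0) × ℝ³` with `div u(t) = 0`, `‖Du(t, x)‖ ≤ C₁/(−t)`,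
`‖∇p(t, x)‖ ≤ C₃/√(−t)³`, a fixed vector `e` and a *tempered modulation* `φ` (smooth on `t < 0`,
`|φ| ≤ M`, `√(−t)|φ'| ≤ M`, `√(−t)³|φ''| ≤ M`), the **modulated Galilean mode**
`v_φ(t, x) = φ'(t) e − φ(t) ∂ₑu(t, x)`, `q_φ(t, x) = −φ''(t)⟪e, x⟫ − φ(t) ∂ₑp(t, x)` satisfies every
clause of "tempered linearised solution" except the momentum equation (which is the neighbouring
stub B2b):

1. `v_φ` is jointly `C^∞` on `(−∞, 0) × ℝ³` (`∂ₑ` of a jointly smooth field is jointly smooth on the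
   open time set, `IsSmoothSpaceTimeOn.isSmoothSpaceTimeOn_fderiv_apply`; `φ'` is smooth on the open
   set `Iio 0`, `ContDiffOn.deriv_of_isOpen`);
2. `q_φ` is jointly `C^∞` there (same, with `φ'' = iteratedDeriv 2 φ = deriv (deriv φ)`);
3. the tempered growth `‖v_φ‖ ≤ K/√(−t) + K(1+‖x‖)/(−t)`, `|q_φ| ≤ K/(−t) + K(1+‖x‖)/√(−t)³` with
   `K = M‖e‖(1 + |C₁| + |C₃|)`, from `|φ'| ≤ M/√(−t)`, `|φ|‖Du‖‖e‖ ≤ M|C₁|‖e‖/(−t)`,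
   `|φ''||⟪e, x⟫| ≤ M‖e‖‖x‖/√(−t)³`, `|φ||∂ₑp| ≤ |φ|‖∇p‖‖e‖ ≤ M|C₃|‖e‖/√(−t)³`;
4. `div v_φ(t) = −φ(t) ∂ₑ(div u(t)) = 0` (`div ∂ₑ = ∂ₑ div` for `C²` fields,
   `divergence_fderiv_apply_eq`).
-/

noncomputable section

open Set Function InnerProductSpace
open scoped ContDiff Topology RealInnerProductSpace

namespace Summit.NavierStokesRegularity.NavierStokesRegularity.Theorems

open Literature.Analysis.FluidPDE

/-! ### Smoothness -/

/-- The derivative of a function smooth on the open half-line `(−∞, 0)` is smooth there. -/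
theorem galileanReg_contDiffOn_deriv {φ : ℝ → ℝ} (hφ : ContDiffOn ℝ ∞ φ (Iio 0)) :
    ContDiffOn ℝ ∞ (deriv φ) (Iio 0) :=
  hφ.deriv_of_isOpen isOpen_Iio (by simp)

/-- The second derivative `iteratedDeriv 2 φ = (φ')'` of a function smooth on `(−∞, 0)` is smooth
there. -/
theorem galileanReg_contDiffOn_iteratedDeriv_two {φ : ℝ → ℝ} (hφ : ContDiffOn ℝ ∞ φ (Iio 0)) :
    ContDiffOn ℝ ∞ (iteratedDeriv 2 φ) (Iio 0) := by
  rw [iteratedDeriv_succ, iteratedDeriv_one]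
  exact galileanReg_contDiffOn_deriv (galileanReg_contDiffOn_deriv hφ)

/-- A function of time only, smooth on `(−∞, 0)`, is a jointly smooth space–time field there. -/
theorem galileanReg_isSmoothSpaceTimeOn_time {X : Type*} [NormedAddCommGroup X] [NormedSpace ℝ X]
    {g : ℝ → ℝ} (hg : ContDiffOn ℝ ∞ g (Iio 0)) :
    IsSmoothSpaceTimeOn (Iio 0) fun (t : ℝ) (_ : X) => g t :=
  hg.comp contDiffOn_fst fun _ hz => hz.1

/-- **(1) The modulated Galilean velocity `φ'e − φ∂ₑu` is jointly smooth on `(−∞, 0) × ℝ³`.** -/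
theorem galileanReg_smooth_velocity
    {u : ℝ → EuclideanSpace ℝ (Fin 3) → EuclideanSpace ℝ (Fin 3)} {φ : ℝ → ℝ}
    (hu : IsSmoothSpaceTimeOn (Iio 0) u) (hφ : ContDiffOn ℝ ∞ φ (Iio 0))
    (e : EuclideanSpace ℝ (Fin 3)) :
    IsSmoothSpaceTimeOn (Iio 0) fun t x => deriv φ t • e - φ t • fderiv ℝ (u t) x e := by
  have h1 : IsSmoothSpaceTimeOn (Iio 0) fun (t : ℝ) (_ : EuclideanSpace ℝ (Fin 3)) =>
      deriv φ t • e :=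
    (galileanReg_isSmoothSpaceTimeOn_time (galileanReg_contDiffOn_deriv hφ)).smul
      (w := fun _ _ => e) contDiffOn_const
  have h2 : IsSmoothSpaceTimeOn (Iio 0) fun t x => φ t • fderiv ℝ (u t) x e :=
    (galileanReg_isSmoothSpaceTimeOn_time hφ).smul
      (hu.isSmoothSpaceTimeOn_fderiv_apply isOpen_Iio e)
  exact h1.sub h2

/-- **(2) The modulated Galilean pressure `−φ''⟪e, x⟫ − φ∂ₑp` is jointly smooth on
`(−∞, 0) × ℝ³`.** -/
theorem galileanReg_smooth_pressure
    {p : ℝ → EuclideanSpace ℝ (Fin 3) → ℝ} {φ : ℝ → ℝ}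
    (hp : IsSmoothSpaceTimeOn (Iio 0) p) (hφ : ContDiffOn ℝ ∞ φ (Iio 0))
    (e : EuclideanSpace ℝ (Fin 3)) :
    IsSmoothSpaceTimeOn (Iio 0) fun t x =>
      -(iteratedDeriv 2 φ t * ⟪e, x⟫) - φ t * fderiv ℝ (p t) x e := by
  have h1 : IsSmoothSpaceTimeOn (Iio 0) fun (t : ℝ) (x : EuclideanSpace ℝ (Fin 3)) =>
      iteratedDeriv 2 φ t * ⟪e, x⟫ :=
    (galileanReg_isSmoothSpaceTimeOn_time (galileanReg_contDiffOn_iteratedDeriv_two hφ)).mul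
      ((isSmoothSpaceTimeOn_const_time contDiff_const _).inner
        (isSmoothSpaceTimeOn_const_time contDiff_id _))
  have h2 : IsSmoothSpaceTimeOn (Iio 0) fun t x => φ t * fderiv ℝ (p t) x e :=
    (galileanReg_isSmoothSpaceTimeOn_time hφ).mul
      (hp.isSmoothSpaceTimeOn_fderiv_apply isOpen_Iio e)
  have h3 : IsSmoothSpaceTimeOn (Iio 0) fun (t : ℝ) (x : EuclideanSpace ℝ (Fin 3)) =>
      -(iteratedDeriv 2 φ t * ⟪e, x⟫) :=
    ContDiffOn.neg h1
  exact h3.sub h2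

/-! ### Tempered growth -/

/-- `∂ₑf(x) = ⟪∇f(x), e⟫`. -/
theorem galileanReg_fderiv_apply_eq_inner_gradient
    (f : EuclideanSpace ℝ (Fin 3) → ℝ) (x e : EuclideanSpace ℝ (Fin 3)) :
    fderiv ℝ f x e = ⟪gradient f x, e⟫ := by
  rw [gradient, InnerProductSpace.toDual_symm_apply]

/-- **(3, velocity) `‖φ'e − φ∂ₑu‖ ≤ M‖e‖/√(−t) + M‖e‖|C₁|/(−t)`.** -/
theorem galileanReg_norm_velocity_le
    {u : ℝ → EuclideanSpace ℝ (Fin 3) → EuclideanSpace ℝ (Fin 3)} {φ : ℝ → ℝ}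
    {e : EuclideanSpace ℝ (Fin 3)} {C₁ M t : ℝ} (ht : t < 0) {x : EuclideanSpace ℝ (Fin 3)}
    (hDu : ‖fderiv ℝ (u t) x‖ ≤ C₁ / (-t)) (hφ0 : |φ t| ≤ M)
    (hφ1 : Real.sqrt (-t) * |deriv φ t| ≤ M) :
    ‖deriv φ t • e - φ t • fderiv ℝ (u t) x e‖ ≤
      M * ‖e‖ / Real.sqrt (-t) + M * ‖e‖ * |C₁| / (-t) := by
  have hs : 0 < Real.sqrt (-t) := Real.sqrt_pos.2 (by linarith)
  have hnt : 0 < -t := by linarith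
  have hM : 0 ≤ M := (abs_nonneg _).trans hφ0
  have h1 : ‖deriv φ t • e‖ ≤ M * ‖e‖ / Real.sqrt (-t) := by
    rw [norm_smul, Real.norm_eq_abs, le_div_iff₀ hs]
    calc |deriv φ t| * ‖e‖ * Real.sqrt (-t) = (Real.sqrt (-t) * |deriv φ t|) * ‖e‖ := by ring
      _ ≤ M * ‖e‖ := by gcongr
  have hDu' : ‖fderiv ℝ (u t) x‖ ≤ |C₁| / (-t) :=
    hDu.trans (div_le_div_of_nonneg_right (le_abs_self C₁) hnt.le)
  have h2 : ‖φ t • fderiv ℝ (u t) x e‖ ≤ M * ‖e‖ * |C₁| / (-t) := by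
    rw [norm_smul, Real.norm_eq_abs]
    calc |φ t| * ‖fderiv ℝ (u t) x e‖ ≤ M * (‖fderiv ℝ (u t) x‖ * ‖e‖) := by
          gcongr
          exact ContinuousLinearMap.le_opNorm _ _
      _ ≤ M * (|C₁| / (-t) * ‖e‖) := by gcongr
      _ = M * ‖e‖ * |C₁| / (-t) := by ring
  exact (norm_sub_le _ _).trans (add_le_add h1 h2)

/-- **(3, pressure) `|−φ''⟪e, x⟫ − φ∂ₑp| ≤ M‖e‖‖x‖/√(−t)³ + M‖e‖|C₃|/√(−t)³`.** -/
theorem galileanReg_abs_pressure_le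
    {p : ℝ → EuclideanSpace ℝ (Fin 3) → ℝ} {φ : ℝ → ℝ}
    {e : EuclideanSpace ℝ (Fin 3)} {C₃ M t : ℝ} (ht : t < 0) {x : EuclideanSpace ℝ (Fin 3)}
    (hDp : ‖gradient (p t) x‖ ≤ C₃ / Real.sqrt (-t) ^ 3) (hφ0 : |φ t| ≤ M)
    (hφ2 : Real.sqrt (-t) ^ 3 * |iteratedDeriv 2 φ t| ≤ M) :
    |-(iteratedDeriv 2 φ t * ⟪e, x⟫) - φ t * fderiv ℝ (p t) x e| ≤
      M * ‖e‖ * ‖x‖ / Real.sqrt (-t) ^ 3 + M * ‖e‖ * |C₃| / Real.sqrt (-t) ^ 3 := by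
  have hs3 : 0 < Real.sqrt (-t) ^ 3 := pow_pos (Real.sqrt_pos.2 (by linarith)) 3
  have hM : 0 ≤ M := (abs_nonneg _).trans hφ0
  have h1 : |-(iteratedDeriv 2 φ t * ⟪e, x⟫)| ≤ M * ‖e‖ * ‖x‖ / Real.sqrt (-t) ^ 3 := by
    rw [abs_neg, abs_mul, le_div_iff₀ hs3]
    calc |iteratedDeriv 2 φ t| * |⟪e, x⟫| * Real.sqrt (-t) ^ 3
        = (Real.sqrt (-t) ^ 3 * |iteratedDeriv 2 φ t|) * |⟪e, x⟫| := by ring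
      _ ≤ M * (‖e‖ * ‖x‖) := by
          gcongr
          exact abs_real_inner_le_norm e x
      _ = M * ‖e‖ * ‖x‖ := by ring
  have hDp' : ‖gradient (p t) x‖ ≤ |C₃| / Real.sqrt (-t) ^ 3 :=
    hDp.trans (div_le_div_of_nonneg_right (le_abs_self C₃) hs3.le)
  have h2 : |φ t * fderiv ℝ (p t) x e| ≤ M * ‖e‖ * |C₃| / Real.sqrt (-t) ^ 3 := by
    rw [abs_mul, galileanReg_fderiv_apply_eq_inner_gradient]
    calc |φ t| * |⟪gradient (p t) x, e⟫| ≤ M * (‖gradient (p t) x‖ * ‖e‖) := by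
          gcongr
          exact abs_real_inner_le_norm _ _
      _ ≤ M * (|C₃| / Real.sqrt (-t) ^ 3 * ‖e‖) := by gcongr
      _ = M * ‖e‖ * |C₃| / Real.sqrt (-t) ^ 3 := by ring
  exact (abs_sub _ _).trans (add_le_add h1 h2)

/-- **(3) The tempered growth bounds** with the constant `K = M‖e‖(1 + |C₁| + |C₃|)`. -/
theorem galileanReg_growth
    {u : ℝ → EuclideanSpace ℝ (Fin 3) → EuclideanSpace ℝ (Fin 3)}
    {p : ℝ → EuclideanSpace ℝ (Fin 3) → ℝ} {φ : ℝ → ℝ} {e : EuclideanSpace ℝ (Fin 3)}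
    {C₁ C₃ M : ℝ}
    (hC₁ : ∀ t < 0, ∀ x, ‖fderiv ℝ (u t) x‖ ≤ C₁ / (-t))
    (hC₃ : ∀ t < 0, ∀ x, ‖gradient (p t) x‖ ≤ C₃ / Real.sqrt (-t) ^ 3)
    (hM : ∀ t < 0, |φ t| ≤ M ∧ Real.sqrt (-t) * |deriv φ t| ≤ M ∧
      Real.sqrt (-t) ^ 3 * |iteratedDeriv 2 φ t| ≤ M) :
    ∀ t < 0, ∀ x,
      ‖deriv φ t • e - φ t • fderiv ℝ (u t) x e‖ ≤
          M * ‖e‖ * (1 + |C₁| + |C₃|) / Real.sqrt (-t) +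
            M * ‖e‖ * (1 + |C₁| + |C₃|) * (1 + ‖x‖) / (-t) ∧
        |-(iteratedDeriv 2 φ t * ⟪e, x⟫) - φ t * fderiv ℝ (p t) x e| ≤
          M * ‖e‖ * (1 + |C₁| + |C₃|) / (-t) +
            M * ‖e‖ * (1 + |C₁| + |C₃|) * (1 + ‖x‖) / Real.sqrt (-t) ^ 3 := by
  intro t ht x
  obtain ⟨hφ0, hφ1, hφ2⟩ := hM t ht
  have hs : 0 < Real.sqrt (-t) := Real.sqrt_pos.2 (by linarith)
  have hs3 : 0 < Real.sqrt (-t) ^ 3 := pow_pos hs 3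
  have hnt : 0 < -t := by linarith
  have hM0 : 0 ≤ M := (abs_nonneg _).trans hφ0
  have hMe : 0 ≤ M * ‖e‖ := mul_nonneg hM0 (norm_nonneg e)
  set K := M * ‖e‖ * (1 + |C₁| + |C₃|) with hK
  have hK0 : 0 ≤ K := mul_nonneg hMe (by positivity)
  have hK1 : M * ‖e‖ ≤ K := by
    have : M * ‖e‖ * 1 ≤ M * ‖e‖ * (1 + |C₁| + |C₃|) :=
      mul_le_mul_of_nonneg_left (by linarith [abs_nonneg C₁, abs_nonneg C₃]) hMe
    linarith
  have hK2 : M * ‖e‖ * |C₁| ≤ K :=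
    mul_le_mul_of_nonneg_left (by linarith [abs_nonneg C₃]) hMe
  have hK3 : M * ‖e‖ * |C₃| ≤ K :=
    mul_le_mul_of_nonneg_left (by linarith [abs_nonneg C₁]) hMe
  have hx1 : (1 : ℝ) ≤ 1 + ‖x‖ := by linarith [norm_nonneg x]
  constructor
  · refine (galileanReg_norm_velocity_le ht (hC₁ t ht x) hφ0 hφ1).trans (add_le_add ?_ ?_)
    · exact div_le_div_of_nonneg_right hK1 hs.le
    · calc M * ‖e‖ * |C₁| / (-t) ≤ K / (-t) := div_le_div_of_nonneg_right hK2 hnt.le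
        _ = K * 1 / (-t) := by rw [mul_one]
        _ ≤ K * (1 + ‖x‖) / (-t) := by gcongr
  · refine (galileanReg_abs_pressure_le ht (hC₃ t ht x) hφ0 hφ2).trans ?_
    calc M * ‖e‖ * ‖x‖ / Real.sqrt (-t) ^ 3 + M * ‖e‖ * |C₃| / Real.sqrt (-t) ^ 3
        ≤ K * ‖x‖ / Real.sqrt (-t) ^ 3 + K / Real.sqrt (-t) ^ 3 := by gcongr
      _ = K * (1 + ‖x‖) / Real.sqrt (-t) ^ 3 := by ring
      _ ≤ K / (-t) + K * (1 + ‖x‖) / Real.sqrt (-t) ^ 3 :=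
          le_add_of_nonneg_left (div_nonneg hK0 hnt.le)

/-! ### Incompressibility -/

/-- **(4) `div(φ'e − φ∂ₑu)(t) = −φ(t) ∂ₑ(div u(t)) = 0`** for `t < 0` when `div u(t) = 0`. -/
theorem galileanReg_isDivFree
    {u : ℝ → EuclideanSpace ℝ (Fin 3) → EuclideanSpace ℝ (Fin 3)}
    (hu : IsSmoothSpaceTimeOn (Iio 0) u) (hdiv : ∀ t < 0, VectorCalculus.IsDivFree (u t))
    (φ : ℝ → ℝ) (e : EuclideanSpace ℝ (Fin 3)) {t : ℝ} (ht : t < 0) :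
    VectorCalculus.IsDivFree fun x => deriv φ t • e - φ t • fderiv ℝ (u t) x e := by
  intro x
  have hU : ContDiff ℝ ∞ (u t) := hu.contDiff_slice ht
  have hg : ContDiff ℝ ∞ (fun y => fderiv ℝ (u t) y e) :=
    (hu.isSmoothSpaceTimeOn_fderiv_apply isOpen_Iio e).contDiff_slice ht
  have hgd : DifferentiableAt ℝ (fun y => fderiv ℝ (u t) y e) x :=
    (hg.differentiable (by simp)).differentiableAt
  have h0 : VectorCalculus.divergence (u t) = fun _ => 0 := funext (hdiv t ht)
  have h1 : VectorCalculus.divergence (fun y => fderiv ℝ (u t) y e) x = 0 := by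
    rw [divergence_fderiv_apply_eq (contDiff_infty.1 hU 2) x e, h0]
    simp
  unfold VectorCalculus.divergence at h1 ⊢
  rw [fderiv_const_sub, fderiv_fun_const_smul hgd]
  simp [h1]

/-! ### The registered stub -/

/-- **Stub B2a: regularity, growth and incompressibility of a modulated Galilean mode.** For
`u, p` jointly smooth on `(−∞,0) × ℝ³` with `div u = 0`, `‖Du‖ ≤ C₁/(−t)`, `‖∇p‖ ≤ C₃/√(−t)³`, and
a tempered modulation `φ` (smooth on `t < 0`, `|φ| ≤ M`, `√(−t)|φ'| ≤ M`, `√(−t)³|φ''| ≤ M`), the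
pair `v = φ'e − φ∂ₑu`, `q = −φ''⟪e,x⟫ − φ∂ₑp` is jointly smooth, tempered (constant
`K = M‖e‖(1 + |C₁| + |C₃|)`), and `div v = 0`. -/
theorem stub_galileanModeRegular :
    ∀ (u : ℝ → EuclideanSpace ℝ (Fin 3) → EuclideanSpace ℝ (Fin 3))
      (p : ℝ → EuclideanSpace ℝ (Fin 3) → ℝ) (φ : ℝ → ℝ) (e : EuclideanSpace ℝ (Fin 3))
      (C₁ C₃ M : ℝ),
      ContDiffOn ℝ (⊤ : ℕ∞) (Function.uncurry u) (Set.Iio 0 ×ˢ Set.univ) →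
      ContDiffOn ℝ (⊤ : ℕ∞) (Function.uncurry p) (Set.Iio 0 ×ˢ Set.univ) →
      (∀ t < 0, Literature.Analysis.FluidPDE.VectorCalculus.IsDivFree (u t)) →
      (∀ t < 0, ∀ x, ‖fderiv ℝ (u t) x‖ ≤ C₁ / (-t)) →
      (∀ t < 0, ∀ x, ‖gradient (p t) x‖ ≤ C₃ / Real.sqrt (-t) ^ 3) →
      ContDiffOn ℝ (⊤ : ℕ∞) φ (Set.Iio 0) →
      (∀ t < 0, |φ t| ≤ M ∧ Real.sqrt (-t) * |deriv φ t| ≤ M ∧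
        Real.sqrt (-t) ^ 3 * |iteratedDeriv 2 φ t| ≤ M) →
      ContDiffOn ℝ (⊤ : ℕ∞)
          (Function.uncurry fun t x => deriv φ t • e - φ t • fderiv ℝ (u t) x e)
          (Set.Iio 0 ×ˢ Set.univ) ∧
        ContDiffOn ℝ (⊤ : ℕ∞)
          (Function.uncurry fun t x => -(iteratedDeriv 2 φ t * inner ℝ e x) - φ t * fderiv ℝ (p t) x e)
          (Set.Iio 0 ×ˢ Set.univ) ∧
        (∃ K : ℝ, ∀ t < 0, ∀ x,
          ‖(fun t x => deriv φ t • e - φ t • fderiv ℝ (u t) x e) t x‖ ≤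
              K / Real.sqrt (-t) + K * (1 + ‖x‖) / (-t) ∧
            |(fun t x => -(iteratedDeriv 2 φ t * inner ℝ e x) - φ t * fderiv ℝ (p t) x e) t x| ≤
              K / (-t) + K * (1 + ‖x‖) / Real.sqrt (-t) ^ 3) ∧
        (∀ t < 0, Literature.Analysis.FluidPDE.VectorCalculus.IsDivFree
          ((fun t x => deriv φ t • e - φ t • fderiv ℝ (u t) x e) t)) := by
  intro u p φ e C₁ C₃ M hu hp hdiv hC₁ hC₃ hφ hM
  have huS : IsSmoothSpaceTimeOn (Iio 0) u := hu
  have hpS : IsSmoothSpaceTimeOn (Iio 0) p := hp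
  refine ⟨galileanReg_smooth_velocity huS hφ e, galileanReg_smooth_pressure hpS hφ e,
    ⟨M * ‖e‖ * (1 + |C₁| + |C₃|), galileanReg_growth hC₁ hC₃ hM⟩,
    fun t ht => galileanReg_isDivFree huS hdiv φ e ht⟩

end Summit.NavierStokesRegularity.NavierStokesRegularity.Theorems
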